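import Mathlib
import HarnessLib
import Summits.NavierStokesRegularity.NavierStokesRegularity.Theorems.PoloidalWindowDoorLrcModEntireSheetSystemUniqueness
import Summits.NavierStokesRegularity.NavierStokesRegularity.Theorems.PoloidalWindowDoorLrcModEntireSheetFlattenTools
import Summits.NavierStokesRegularity.NavierStokesRegularity.Theorems.PoloidalWindowDoorLrcModEntireRidgeWebDynamics

/-!
# Route `PoloidalWindowDoor`, item `LrcModEntire` (stmt-NavierStokesRegularity-20428), cell (Q4-sonic), slot `stub_Q4sonicLineNeg`, case I —
# S4a OF THE ASSEMBLY A-I: THE MOVING SHEAR (SHEARED SPACE–TIME COORDINATES OF THE WEB SHEET) AND ITS CHAIN RULES, in the currency of B-CK2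

Cell ns-regularity-ideate, helper seat ns-k2-port-2 g8 under the LEAD of item 20428 (ns-poloidal-K2-p3 g17, memo `T2B-g17.md` v4 §7 S4 «the pair system in sheared
coordinates … the heavy typing: chain rules for ∂_t′, ∂_z′ of functions composed with the moving shear»); `--supports stmt-NavierStokesRegularity-20428 --as helper`.
Class-free calculus.

THE SHEAR.  Tangential variables `y = (t, s, z) ∈ Y := ℝ × ℝ × ℝ`, normal variable `m ∈ ℝ` (the tube `O × ℝ` of `…SheetSystemUniqueness`), a horizontal vector `e`
and an offset function `d(t,z)`:
`Φ((t,s,z), m) = (t, s·e + (m + d(t,z))·Je + z·e₂) ∈ ℝ × ℝ³` (`shearMap`; space part `shearPt`).  The web sheet `{n = d(t,z)}` of case I is `{m = 0}`.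

CHAIN RULES for `G = F ∘ Φ` (`F` differentiable at `Φ p`, `d` differentiable at `(t,z)`; `d_t := Dd(t,z)[(1,0)]`, `d_z := Dd(t,z)[(0,1)]`), in the `pd`/`dN`/`tg`
notation of B-CK2 (`eT = (1,0,0)`, `eS = (0,1,0)`, `eZ = (0,0,1)`):
* `pd_dN_comp_shearMap`:  `∂_m G = D F(Φp)[(0, Je)]`;
* `pd_tgS_comp_shearMap`: `∂_s G = D F(Φp)[(0, e)]`;
* `pd_tgZ_comp_shearMap`: `∂_z′ G = D F(Φp)[(0, e₂)] + d_z·D F(Φp)[(0, Je)]`, i.e. `(∂_z′ − d_z∂_m)G = (∂_{e₂}F)∘Φ`;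
* `pd_tgT_comp_shearMap`: `∂_t′ G = D F(Φp)[(1, 0)] + d_t·D F(Φp)[(0, Je)]`, i.e. `(∂_t′ − d_t∂_m)G = (∂_tF)∘Φ`;
* `pd_dN_pd_dN_comp_shearMap`, `pd_tgS_pd_tgS_comp_shearMap` (on the tube, `F ∈ C^∞(T × ℝ³)`, `d ∈ C^∞(D)`): `∂_m²G = D²F(Φp)[(0,Je),(0,Je)]`,
  `∂_s²G = D²F(Φp)[(0,e),(0,e)]` — so `∂_s²G + ∂_m²G` is the pull-back of the horizontal Laplacian in the frame `(e, Je)`;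
* `contDiffOn_comp_shearMap` (smoothness on the tube), `analyticOnNhd_normalLine_comp_shearMap` (analyticity along the normal lines from analyticity of the slices
  `F(t,·)` — the inputs `hψ/hg/hψan/hgan` of `…SheetSystemUniqueness.system_eq_zero_on_tube`).
WHAT THIS IS NOT: not a claim about Navier–Stokes regularity — coordinates for the research slot `stub_Q4sonicLineNeg` (registry twist_split v12); no stub is closed
here; items 20428 / 19708 / 27893 OPEN.
-/

noncomputable section

set_option linter.dupNamespace false
set_option linter.style.longLine false

namespace Summit.NavierStokesRegularity.NavierStokesRegularity.Theorems.PoloidalWindowDoorLrcModEntireShearedCoordinates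

open Set Function Filter Topology
open scoped ContDiff
open Summit.NavierStokesRegularity.NavierStokesRegularity.Theorems.PoloidalWindowDoorLrcModEntireSheetSystemUniqueness
open Summit.NavierStokesRegularity.NavierStokesRegularity.Theorems.PoloidalWindowDoorLrcModEntireSheetFlattenTools

/-- The tangential parameter space `Y = ℝ × ℝ × ℝ ∋ (t, s, z)`; points of the tube are `p = ((t,s,z), m)`. -/
abbrev Y3 : Type := ℝ × ℝ × ℝ

/-- The unit tangential directions `eT = (1,0,0)`, `eS = (0,1,0)`, `eZ = (0,0,1)` of `Y`. -/
def eT : Y3 := ((1 : ℝ), (0 : ℝ), (0 : ℝ))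
/-- See `eT`. -/
def eS : Y3 := ((0 : ℝ), (1 : ℝ), (0 : ℝ))
/-- See `eT`. -/
def eZ : Y3 := ((0 : ℝ), (0 : ℝ), (1 : ℝ))

/-- The `(t,z)`-projection `((t,s,z),m) ↦ (t,z)` as a continuous linear map. -/
def tzL : (Y3 × ℝ) →L[ℝ] ℝ × ℝ :=
  ((ContinuousLinearMap.fst ℝ ℝ (ℝ × ℝ)).comp (ContinuousLinearMap.fst ℝ Y3 ℝ)).prod
    (((ContinuousLinearMap.snd ℝ ℝ ℝ).comp (ContinuousLinearMap.snd ℝ ℝ (ℝ × ℝ))).comp (ContinuousLinearMap.fst ℝ Y3 ℝ))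
/-- The `t`-projection. -/
def tL : (Y3 × ℝ) →L[ℝ] ℝ := (ContinuousLinearMap.fst ℝ ℝ (ℝ × ℝ)).comp (ContinuousLinearMap.fst ℝ Y3 ℝ)
/-- The `s`-projection. -/
def sL : (Y3 × ℝ) →L[ℝ] ℝ := ((ContinuousLinearMap.fst ℝ ℝ ℝ).comp (ContinuousLinearMap.snd ℝ ℝ (ℝ × ℝ))).comp (ContinuousLinearMap.fst ℝ Y3 ℝ)
/-- The `z`-projection. -/
def zL : (Y3 × ℝ) →L[ℝ] ℝ := ((ContinuousLinearMap.snd ℝ ℝ ℝ).comp (ContinuousLinearMap.snd ℝ ℝ (ℝ × ℝ))).comp (ContinuousLinearMap.fst ℝ Y3 ℝ)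
/-- The `m`-projection. -/
def mL : (Y3 × ℝ) →L[ℝ] ℝ := ContinuousLinearMap.snd ℝ Y3 ℝ

/-- `tzL` evaluates to `(t,z)`. -/
@[simp] theorem tzL_apply (p : Y3 × ℝ) : tzL p = (p.1.1, p.1.2.2) := rfl
/-- `tL` evaluates to `t`. -/
@[simp] theorem tL_apply (p : Y3 × ℝ) : tL p = p.1.1 := rfl
/-- `sL` evaluates to `s`. -/
@[simp] theorem sL_apply (p : Y3 × ℝ) : sL p = p.1.2.1 := rfl
/-- `zL` evaluates to `z`. -/
@[simp] theorem zL_apply (p : Y3 × ℝ) : zL p = p.1.2.2 := rfl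
/-- `mL` evaluates to `m`. -/
@[simp] theorem mL_apply (p : Y3 × ℝ) : mL p = p.2 := rfl

variable (e : EuclideanSpace ℝ (Fin 3)) (d : ℝ × ℝ → ℝ)

/-- The space part of the moving shear: `((t,s,z),m) ↦ s·e + (m + d(t,z))·Je + z·e₂`. -/
def shearPt (p : Y3 × ℝ) : EuclideanSpace ℝ (Fin 3) := p.1.2.1 • e + (p.2 + d (p.1.1, p.1.2.2)) • Jvec e + p.1.2.2 • e2

/-- The moving shear `Φ((t,s,z),m) = (t, s·e + (m + d(t,z))·Je + z·e₂)`. -/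
def shearMap (p : Y3 × ℝ) : ℝ × EuclideanSpace ℝ (Fin 3) := (p.1.1, shearPt e d p)

/-- The derivative of `shearPt` at `p`: `v ↦ v_s·e + (v_m + Dd(t,z)[(v_t,v_z)])·Je + v_z·e₂`. -/
def shearPtDeriv (p : Y3 × ℝ) : (Y3 × ℝ) →L[ℝ] EuclideanSpace ℝ (Fin 3) :=
  sL.smulRight e + (mL + (fderiv ℝ d (p.1.1, p.1.2.2)).comp tzL).smulRight (Jvec e) + zL.smulRight e2

/-- Evaluation of `shearPtDeriv`. -/
theorem shearPtDeriv_apply (p v : Y3 × ℝ) :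
    shearPtDeriv e d p v = v.1.2.1 • e + (v.2 + fderiv ℝ d (p.1.1, p.1.2.2) (v.1.1, v.1.2.2)) • Jvec e + v.1.2.2 • e2 := by
  simp [shearPtDeriv]

/-- `shearPt` is differentiable with the stated derivative wherever `d` is differentiable. -/
theorem hasFDerivAt_shearPt {p : Y3 × ℝ} (hd : DifferentiableAt ℝ d (p.1.1, p.1.2.2)) :
    HasFDerivAt (shearPt e d) (shearPtDeriv e d p) p := by
  have hd' : HasFDerivAt (fun q : Y3 × ℝ => d (tzL q)) ((fderiv ℝ d (p.1.1, p.1.2.2)).comp tzL) p := by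
    have h := hd.hasFDerivAt
    rw [← tzL_apply p] at h
    exact h.comp p tzL.hasFDerivAt
  have h := ((sL.hasFDerivAt (x := p)).smul_const e).add
    (((mL.hasFDerivAt (x := p)).add hd').smul_const (Jvec e)) |>.add ((zL.hasFDerivAt (x := p)).smul_const e2)
  exact h.congr_of_eventuallyEq (Eventually.of_forall fun q => by simp [shearPt])

/-- The moving shear is differentiable with derivative `v ↦ (v_t, shearPtDeriv v)`. -/
theorem hasFDerivAt_shearMap {p : Y3 × ℝ} (hd : DifferentiableAt ℝ d (p.1.1, p.1.2.2)) :
    HasFDerivAt (shearMap e d) (tL.prod (shearPtDeriv e d p)) p := by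
  have h := (tL.hasFDerivAt (x := p)).prodMk (hasFDerivAt_shearPt e d hd)
  exact h.congr_of_eventuallyEq (Eventually.of_forall fun q => by simp [shearMap])

/-- **Master chain rule:** `D(F∘Φ)(p)[v] = DF(Φp)[(v_t, v_s·e + (v_m + Dd[(v_t,v_z)])·Je + v_z·e₂)]`. -/
theorem fderiv_comp_shearMap {F : ℝ × EuclideanSpace ℝ (Fin 3) → ℝ} {p : Y3 × ℝ} (hF : DifferentiableAt ℝ F (shearMap e d p))
    (hd : DifferentiableAt ℝ d (p.1.1, p.1.2.2)) (v : Y3 × ℝ) :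
    fderiv ℝ (F ∘ shearMap e d) p v =
      fderiv ℝ F (shearMap e d p) (v.1.1, v.1.2.1 • e + (v.2 + fderiv ℝ d (p.1.1, p.1.2.2) (v.1.1, v.1.2.2)) • Jvec e + v.1.2.2 • e2) := by
  rw [(hF.hasFDerivAt.comp p (hasFDerivAt_shearMap e d hd)).fderiv]
  simp [shearPtDeriv_apply]

/-- `∂_m(F∘Φ)(p) = DF(Φp)[(0, Je)]`. -/
theorem pd_dN_comp_shearMap {F : ℝ × EuclideanSpace ℝ (Fin 3) → ℝ} {p : Y3 × ℝ} (hF : DifferentiableAt ℝ F (shearMap e d p))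
    (hd : DifferentiableAt ℝ d (p.1.1, p.1.2.2)) :
    pd dN (F ∘ shearMap e d) p = fderiv ℝ F (shearMap e d p) ((0 : ℝ), Jvec e) := by
  unfold pd dN
  rw [fderiv_comp_shearMap e d hF hd]
  have h0 : fderiv ℝ d (p.1.1, p.1.2.2) ((0 : ℝ), (0 : ℝ)) = 0 := by
    rw [show ((0 : ℝ), (0 : ℝ)) = (0 : ℝ × ℝ) from rfl, map_zero]
  simp [h0]

/-- `∂_s(F∘Φ)(p) = DF(Φp)[(0, e)]`. -/
theorem pd_tgS_comp_shearMap {F : ℝ × EuclideanSpace ℝ (Fin 3) → ℝ} {p : Y3 × ℝ} (hF : DifferentiableAt ℝ F (shearMap e d p))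
    (hd : DifferentiableAt ℝ d (p.1.1, p.1.2.2)) :
    pd (tg eS) (F ∘ shearMap e d) p = fderiv ℝ F (shearMap e d p) ((0 : ℝ), e) := by
  unfold pd tg eS
  rw [fderiv_comp_shearMap e d hF hd]
  have h0 : fderiv ℝ d (p.1.1, p.1.2.2) ((0 : ℝ), (0 : ℝ)) = 0 := by
    rw [show ((0 : ℝ), (0 : ℝ)) = (0 : ℝ × ℝ) from rfl, map_zero]
  simp [h0]

/-- `∂_z′(F∘Φ)(p) = DF(Φp)[(0, e₂)] + d_z·DF(Φp)[(0, Je)]`, `d_z = Dd(t,z)[(0,1)]`. -/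
theorem pd_tgZ_comp_shearMap {F : ℝ × EuclideanSpace ℝ (Fin 3) → ℝ} {p : Y3 × ℝ} (hF : DifferentiableAt ℝ F (shearMap e d p))
    (hd : DifferentiableAt ℝ d (p.1.1, p.1.2.2)) :
    pd (tg eZ) (F ∘ shearMap e d) p =
      fderiv ℝ F (shearMap e d p) ((0 : ℝ), e2) + fderiv ℝ d (p.1.1, p.1.2.2) ((0 : ℝ), (1 : ℝ)) * fderiv ℝ F (shearMap e d p) ((0 : ℝ), Jvec e) := by
  unfold pd tg eZ
  rw [fderiv_comp_shearMap e d hF hd]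
  have hsplit : (((0 : ℝ), fderiv ℝ d (p.1.1, p.1.2.2) ((0 : ℝ), (1 : ℝ)) • Jvec e + e2) : ℝ × EuclideanSpace ℝ (Fin 3)) =
      (((0 : ℝ), e2) : ℝ × EuclideanSpace ℝ (Fin 3)) + fderiv ℝ d (p.1.1, p.1.2.2) ((0 : ℝ), (1 : ℝ)) • (((0 : ℝ), Jvec e) : ℝ × EuclideanSpace ℝ (Fin 3)) := by
    ext <;> simp [add_comm]
  simp only [zero_smul, zero_add, one_smul]
  rw [hsplit, map_add, map_smul, smul_eq_mul]

/-- `∂_t′(F∘Φ)(p) = DF(Φp)[(1, 0)] + d_t·DF(Φp)[(0, Je)]`, `d_t = Dd(t,z)[(1,0)]`. -/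
theorem pd_tgT_comp_shearMap {F : ℝ × EuclideanSpace ℝ (Fin 3) → ℝ} {p : Y3 × ℝ} (hF : DifferentiableAt ℝ F (shearMap e d p))
    (hd : DifferentiableAt ℝ d (p.1.1, p.1.2.2)) :
    pd (tg eT) (F ∘ shearMap e d) p =
      fderiv ℝ F (shearMap e d p) ((1 : ℝ), (0 : EuclideanSpace ℝ (Fin 3))) +
        fderiv ℝ d (p.1.1, p.1.2.2) ((1 : ℝ), (0 : ℝ)) * fderiv ℝ F (shearMap e d p) ((0 : ℝ), Jvec e) := by
  unfold pd tg eT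
  rw [fderiv_comp_shearMap e d hF hd]
  have hsplit : (((1 : ℝ), fderiv ℝ d (p.1.1, p.1.2.2) ((1 : ℝ), (0 : ℝ)) • Jvec e) : ℝ × EuclideanSpace ℝ (Fin 3)) =
      (((1 : ℝ), (0 : EuclideanSpace ℝ (Fin 3))) : ℝ × EuclideanSpace ℝ (Fin 3)) +
        fderiv ℝ d (p.1.1, p.1.2.2) ((1 : ℝ), (0 : ℝ)) • (((0 : ℝ), Jvec e) : ℝ × EuclideanSpace ℝ (Fin 3)) := by
    ext <;> simp
  simp only [zero_smul, zero_add, add_zero]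
  rw [hsplit, map_add, map_smul, smul_eq_mul]

/-- The straightened normal-height derivative: `(∂_z′ − d_z∂_m)(F∘Φ) = (∂_{e₂}F)∘Φ`. -/
theorem pd_tgZ_sub_comp_shearMap {F : ℝ × EuclideanSpace ℝ (Fin 3) → ℝ} {p : Y3 × ℝ} (hF : DifferentiableAt ℝ F (shearMap e d p))
    (hd : DifferentiableAt ℝ d (p.1.1, p.1.2.2)) :
    pd (tg eZ) (F ∘ shearMap e d) p - fderiv ℝ d (p.1.1, p.1.2.2) ((0 : ℝ), (1 : ℝ)) * pd dN (F ∘ shearMap e d) p =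
      fderiv ℝ F (shearMap e d p) ((0 : ℝ), e2) := by
  rw [pd_tgZ_comp_shearMap e d hF hd, pd_dN_comp_shearMap e d hF hd]; ring

/-- The straightened time derivative: `(∂_t′ − d_t∂_m)(F∘Φ) = (∂_tF)∘Φ`. -/
theorem pd_tgT_sub_comp_shearMap {F : ℝ × EuclideanSpace ℝ (Fin 3) → ℝ} {p : Y3 × ℝ} (hF : DifferentiableAt ℝ F (shearMap e d p))
    (hd : DifferentiableAt ℝ d (p.1.1, p.1.2.2)) :
    pd (tg eT) (F ∘ shearMap e d) p - fderiv ℝ d (p.1.1, p.1.2.2) ((1 : ℝ), (0 : ℝ)) * pd dN (F ∘ shearMap e d) p =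
      fderiv ℝ F (shearMap e d p) ((1 : ℝ), (0 : EuclideanSpace ℝ (Fin 3))) := by
  rw [pd_tgT_comp_shearMap e d hF hd, pd_dN_comp_shearMap e d hF hd]; ring

/-! ### On the tube: smoothness, second derivatives, analyticity along normal lines -/

variable {e d}
variable {O : Set Y3} {D : Set (ℝ × ℝ)} {T : Set ℝ} {F : ℝ × EuclideanSpace ℝ (Fin 3) → ℝ}

/-- The shear maps the tube over `O` into `T × ℝ³` when `O`'s time range lies in `T`. -/
theorem shearMap_mem {p : Y3 × ℝ} (hOT : ∀ y ∈ O, y.1 ∈ T) (hp : p ∈ tube O) :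
    shearMap e d p ∈ T ×ˢ (univ : Set (EuclideanSpace ℝ (Fin 3))) := ⟨hOT p.1 hp, mem_univ _⟩

/-- The moving shear is `C^∞` on the tube when `d ∈ C^∞(D)`, `D` open, `(t,z) ∈ D` over `O`. -/
theorem contDiffOn_shearMap (hD : IsOpen D) (hd : ContDiffOn ℝ ∞ d D) (hOD : ∀ y ∈ O, (y.1, y.2.2) ∈ D) :
    ContDiffOn ℝ ∞ (shearMap e d) (tube O) := by
  have hdc : ContDiffOn ℝ ∞ (fun q : Y3 × ℝ => d (tzL q)) (tube O) := by
    intro q hq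
    have hq' : tzL q ∈ D := by rw [tzL_apply]; exact hOD q.1 hq
    exact ((hd.contDiffAt (hD.mem_nhds hq')).comp q tzL.contDiff.contDiffAt).contDiffWithinAt
  have h1 : ContDiffOn ℝ ∞ (fun q : Y3 × ℝ => sL q • e + (mL q + d (tzL q)) • Jvec e + zL q • e2) (tube O) :=
    ((sL.contDiff.contDiffOn.smul contDiffOn_const).add ((mL.contDiff.contDiffOn.add hdc).smul contDiffOn_const)).add
      (zL.contDiff.contDiffOn.smul contDiffOn_const)
  have hfun : (fun q : Y3 × ℝ => sL q • e + (mL q + d (tzL q)) • Jvec e + zL q • e2) = shearPt e d := by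
    funext q; simp [shearPt]
  rw [hfun] at h1
  have h2 : ContDiffOn ℝ ∞ (fun q : Y3 × ℝ => (tL q, shearPt e d q)) (tube O) := tL.contDiff.contDiffOn.prodMk h1
  have hfun2 : (fun q : Y3 × ℝ => (tL q, shearPt e d q)) = shearMap e d := by funext q; simp [shearMap]
  rw [hfun2] at h2
  exact h2

/-- **Smoothness on the tube:** `F ∈ C^∞(T × ℝ³)` (`T` open), `d ∈ C^∞(D)` ⇒ `F ∘ Φ ∈ C^∞(tube O)`. -/
theorem contDiffOn_comp_shearMap (hT : IsOpen T) (hF : ContDiffOn ℝ ∞ F (T ×ˢ (univ : Set (EuclideanSpace ℝ (Fin 3)))))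
    (hOT : ∀ y ∈ O, y.1 ∈ T) (hD : IsOpen D) (hd : ContDiffOn ℝ ∞ d D) (hOD : ∀ y ∈ O, (y.1, y.2.2) ∈ D) :
    ContDiffOn ℝ ∞ (F ∘ shearMap e d) (tube O) := by
  intro p hp
  have hΦ := (contDiffOn_shearMap (e := e) hD hd hOD) p hp
  have hFp : ContDiffAt ℝ ∞ F (shearMap e d p) := hF.contDiffAt ((hT.prod isOpen_univ).mem_nhds (shearMap_mem hOT hp))
  exact hFp.comp_contDiffWithinAt p hΦ

/-- Differentiability facts at a point of the tube. -/
theorem differentiableAt_data (hT : IsOpen T) (hF : ContDiffOn ℝ ∞ F (T ×ˢ (univ : Set (EuclideanSpace ℝ (Fin 3)))))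
    (hOT : ∀ y ∈ O, y.1 ∈ T) (hD : IsOpen D) (hd : ContDiffOn ℝ ∞ d D) (hOD : ∀ y ∈ O, (y.1, y.2.2) ∈ D) {p : Y3 × ℝ} (hp : p ∈ tube O) :
    DifferentiableAt ℝ F (shearMap e d p) ∧ DifferentiableAt ℝ (fderiv ℝ F) (shearMap e d p) ∧ DifferentiableAt ℝ d (p.1.1, p.1.2.2) := by
  have hFp : ContDiffAt ℝ ∞ F (shearMap e d p) := hF.contDiffAt ((hT.prod isOpen_univ).mem_nhds (shearMap_mem hOT hp))
  refine ⟨hFp.differentiableAt (by simp), (hFp.fderiv_right (m := 1) (by norm_cast)).differentiableAt (by norm_num), ?_⟩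
  exact (hd.contDiffAt (hD.mem_nhds (hOD p.1 hp))).differentiableAt (by simp)

/-- **`∂_m²(F∘Φ) = D²F(Φp)[(0,Je),(0,Je)]`** on the tube. -/
theorem pd_dN_pd_dN_comp_shearMap (hO : IsOpen O) (hT : IsOpen T) (hF : ContDiffOn ℝ ∞ F (T ×ˢ (univ : Set (EuclideanSpace ℝ (Fin 3)))))
    (hOT : ∀ y ∈ O, y.1 ∈ T) (hD : IsOpen D) (hd : ContDiffOn ℝ ∞ d D) (hOD : ∀ y ∈ O, (y.1, y.2.2) ∈ D) {p : Y3 × ℝ} (hp : p ∈ tube O) :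
    pd dN (pd dN (F ∘ shearMap e d)) p =
      fderiv ℝ (fderiv ℝ F) (shearMap e d p) ((0 : ℝ), Jvec e) ((0 : ℝ), Jvec e) := by
  obtain ⟨hFd, hDFd, hdp⟩ := differentiableAt_data hT hF hOT hD hd hOD hp
  -- `∂_m G` agrees near `p` with `(q ↦ DF(q)[(0,Je)]) ∘ Φ`
  have hev : pd dN (F ∘ shearMap e d) =ᶠ[𝓝 p] ((fun x => fderiv ℝ F x ((0 : ℝ), Jvec e)) ∘ shearMap e d) := by
    filter_upwards [(isOpen_tube hO).mem_nhds hp] with q hq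
    obtain ⟨hFq, -, hdq⟩ := differentiableAt_data hT hF hOT hD hd hOD hq
    exact pd_dN_comp_shearMap e d hFq hdq
  show fderiv ℝ (pd dN (F ∘ shearMap e d)) p dN = _
  rw [hev.fderiv_eq]
  have hF1 : DifferentiableAt ℝ (fun x => fderiv ℝ F x ((0 : ℝ), Jvec e)) (shearMap e d p) := by
    have e1 : (fun x => fderiv ℝ F x ((0 : ℝ), Jvec e)) = (ContinuousLinearMap.apply ℝ ℝ (((0 : ℝ), Jvec e) : ℝ × EuclideanSpace ℝ (Fin 3))) ∘ fderiv ℝ F := by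
      funext x; simp
    rw [e1]; exact (ContinuousLinearMap.differentiableAt _).comp _ hDFd
  have h := pd_dN_comp_shearMap e d (F := fun x => fderiv ℝ F x ((0 : ℝ), Jvec e)) hF1 hdp
  unfold pd at h
  rw [h, PoloidalWindowDoorLrcModEntireRidgeWebDynamics.fderiv_partial_apply' hDFd]

/-- **`∂_s²(F∘Φ) = D²F(Φp)[(0,e),(0,e)]`** on the tube. -/
theorem pd_tgS_pd_tgS_comp_shearMap (hO : IsOpen O) (hT : IsOpen T) (hF : ContDiffOn ℝ ∞ F (T ×ˢ (univ : Set (EuclideanSpace ℝ (Fin 3)))))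
    (hOT : ∀ y ∈ O, y.1 ∈ T) (hD : IsOpen D) (hd : ContDiffOn ℝ ∞ d D) (hOD : ∀ y ∈ O, (y.1, y.2.2) ∈ D) {p : Y3 × ℝ} (hp : p ∈ tube O) :
    pd (tg eS) (pd (tg eS) (F ∘ shearMap e d)) p =
      fderiv ℝ (fderiv ℝ F) (shearMap e d p) ((0 : ℝ), e) ((0 : ℝ), e) := by
  obtain ⟨hFd, hDFd, hdp⟩ := differentiableAt_data hT hF hOT hD hd hOD hp
  have hev : pd (tg eS) (F ∘ shearMap e d) =ᶠ[𝓝 p] ((fun x => fderiv ℝ F x ((0 : ℝ), e)) ∘ shearMap e d) := by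
    filter_upwards [(isOpen_tube hO).mem_nhds hp] with q hq
    obtain ⟨hFq, -, hdq⟩ := differentiableAt_data hT hF hOT hD hd hOD hq
    exact pd_tgS_comp_shearMap e d hFq hdq
  show fderiv ℝ (pd (tg eS) (F ∘ shearMap e d)) p (tg eS) = _
  rw [hev.fderiv_eq]
  have hF1 : DifferentiableAt ℝ (fun x => fderiv ℝ F x ((0 : ℝ), e)) (shearMap e d p) := by
    have e1 : (fun x => fderiv ℝ F x ((0 : ℝ), e)) = (ContinuousLinearMap.apply ℝ ℝ (((0 : ℝ), e) : ℝ × EuclideanSpace ℝ (Fin 3))) ∘ fderiv ℝ F := by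
      funext x; simp
    rw [e1]; exact (ContinuousLinearMap.differentiableAt _).comp _ hDFd
  have h := pd_tgS_comp_shearMap e d (F := fun x => fderiv ℝ F x ((0 : ℝ), e)) hF1 hdp
  unfold pd at h
  rw [h, PoloidalWindowDoorLrcModEntireRidgeWebDynamics.fderiv_partial_apply' hDFd]

/-- **Analyticity along the normal lines:** if every slice `F(t,·)`, `t ∈ T`, is real-analytic on `ℝ³`, then `r ↦ (F∘Φ)(y, r)` is real-analytic on `ℝ` for
every `y ∈ O` (the line `r ↦ s·e + (r + d(t,z))·Je + z·e₂` is affine). -/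
theorem analyticOnNhd_normalLine_comp_shearMap (hFan : ∀ t ∈ T, AnalyticOnNhd ℝ (fun x : EuclideanSpace ℝ (Fin 3) => F (t, x)) univ)
    (hOT : ∀ y ∈ O, y.1 ∈ T) {y : Y3} (hy : y ∈ O) :
    AnalyticOnNhd ℝ (fun r : ℝ => (F ∘ shearMap e d) (y, r)) univ := by
  intro r _
  have hline : AnalyticAt ℝ (fun r : ℝ => y.2.1 • e + (r + d (y.1, y.2.2)) • Jvec e + y.2.2 • e2) r := by
    have h1 : AnalyticAt ℝ (fun r : ℝ => (r + d (y.1, y.2.2)) • Jvec e) r :=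
      ((analyticAt_id).add analyticAt_const).smul analyticAt_const
    exact (analyticAt_const.add h1).add analyticAt_const
  have hcomp := (hFan y.1 (hOT y hy) _ (mem_univ _)).comp hline
  have hfun : ((fun x : EuclideanSpace ℝ (Fin 3) => F (y.1, x)) ∘ fun r : ℝ => y.2.1 • e + (r + d (y.1, y.2.2)) • Jvec e + y.2.2 • e2) =
      fun r : ℝ => (F ∘ shearMap e d) (y, r) := by
    funext r; simp [shearMap, shearPt]
  rw [hfun] at hcomp
  exact hcomp

end Summit.NavierStokesRegularity.NavierStokesRegularity.Theorems.PoloidalWindowDoorLrcModEntireShearedCoordinates
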